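import Mathlib
import HarnessLib
import Summits.AtomisticToContinuum.Crystallization.Theses.FlatToriSuffice

/-!
# Line `two-regimes-scale-two` — birth skeleton of `TwoShellDefectGap`
(X_T of the scale split of `TorusDefectGap`; item `stmt-AtomisticToContinuum-11952`, rank 3,
route `FlatToriSuffice`)

`TwoShellDefectGap` (∀ minimiser P₀ ∀ η > 0 ∃ g > 0 ∀ periodic P, g·#bad_(2,η)(P; P₀) ≤ #motif·(e(P) − e(P₀)))
⟸ the two REGIMES of the bad fraction θ(P) = #bad_(2,η)/#motif, glued by θ ≤ 1:

* `stub_diluteTwoShellPricing` — DILUTE REGIME (local / perturbative toolkit): for some density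
  `θ₀ > 0` and price `g > 0`, every periodic `P` with `#bad ≤ θ₀·#motif` satisfies the linear gap.
  "Every dilute two-shell defect has a uniformly positive formation energy per bad point at chemical
  potential e(P₀)": vacancies / interstitials O(1), stacking faults ~|J₂| per faulted row (the Hägg
  bet), dislocation cores + priced elastic far field, η-strained regions ~(η/2)² per point.
* `stub_qualitativeTwoShellRigidity` — NON-DILUTE REGIME (global / compactness + uniqueness toolkit):
  for every `θ₀ > 0` there is `κ > 0` with `e(P) ≥ e(P₀) + κ` for every periodic `P` whose bad fraction
  exceeds `θ₀`. "No periodic competitor with a positive fraction of non-P₀-like two-shell environments is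
  nearly optimal": polytype selection (fcc, dhcp, … are 100 % bad w.r.t. hcp at radius 2 > √(8/3)a*),
  no amorphous / icosahedral / Frank–Kasper near-minimiser; qualitative — no rate.
* `TwoShellDefectGap_of` — PROVED gluing: `g' := min g κ`; dilute case by stub 1; otherwise
  `κ ≤ e(P) − e(P₀)` and `#bad ≤ #motif` give `κ·#bad ≤ #motif·(e(P) − e(P₀))`.

Neither stub gives X_T alone (stub 1 is silent on non-dilute competitors such as fcc; stub 2 has no
rate), and X_T implies both.
-/

noncomputable section

open scoped Classical

namespace Summit.AtomisticToContinuum.Crystallization.Cruxes.TwoShellDefectGap.TwoRegimesScaleTwo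

open Literature.MathematicalPhysics.StatisticalMechanics
open Summit.AtomisticToContinuum.Crystallization.Theses.FlatToriSuffice (TwoShellDefectGap)

local notation "E3" => EuclideanSpace ℝ (Fin 3)
local notation "PC" => Literature.MathematicalPhysics.StatisticalMechanics.PeriodicConfiguration 3

/-- `(2, η)`-goodness (the matching clauses of `TwoShellDefectGap` verbatim). -/
def Good₂ (P₀ P : PC) (η : ℝ) (x : E3) : Prop :=
  ∃ p₀ ∈ P₀.motif, ∃ A : E3 ≃ₗᵢ[ℝ] E3,
    (∀ p ∈ P₀.points, dist p p₀ ≤ (2 : ℝ) → ∃ y ∈ P.points, dist y (x + A (p - p₀)) ≤ η) ∧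
    (∀ y ∈ P.points, dist y x ≤ (2 : ℝ) → ∃ p ∈ P₀.points, dist y (x + A (p - p₀)) ≤ η)

/-- `P₀` is a periodic LJ minimiser. -/
def IsMin (P₀ : PC) : Prop :=
  IsLeast (Set.range fun Q : PC => Q.energyPerParticle lennardJones)
    (P₀.energyPerParticle lennardJones)

/-- STUB 1 statement — DILUTE REGIME: linear pricing of dilute two-shell defects. -/
def DiluteTwoShellPricing : Prop :=
  ∀ P₀ : PC, IsMin P₀ → ∀ η : ℝ, 0 < η → ∃ θ₀ g : ℝ, 0 < θ₀ ∧ 0 < g ∧ ∀ P : PC,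
    ({x : E3 | x ∈ P.motif ∧ ¬ Good₂ P₀ P η x}.ncard : ℝ) ≤ θ₀ * P.motif.card →
    g * ({x : E3 | x ∈ P.motif ∧ ¬ Good₂ P₀ P η x}.ncard : ℝ)
      ≤ (P.motif.card : ℝ) *
        (P.energyPerParticle lennardJones - P₀.energyPerParticle lennardJones)

/-- STUB 2 statement — NON-DILUTE REGIME: qualitative two-shell rigidity of near-minimisers. -/
def QualitativeTwoShellRigidity : Prop :=
  ∀ P₀ : PC, IsMin P₀ → ∀ η : ℝ, 0 < η → ∀ θ₀ : ℝ, 0 < θ₀ → ∃ κ : ℝ, 0 < κ ∧ ∀ P : PC,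
    θ₀ * P.motif.card < ({x : E3 | x ∈ P.motif ∧ ¬ Good₂ P₀ P η x}.ncard : ℝ) →
    κ ≤ P.energyPerParticle lennardJones - P₀.energyPerParticle lennardJones

/-- **Stub 1 — dilute regime.** Uniformly positive formation energy per `(2, η)`-bad point for
DILUTE defects in periodic competitors of a minimiser, at chemical potential `e(P₀)` (point defects,
stacking faults — the `|J₂| > 0` / Hägg bet —, dislocations with priced elastic fields, strained
regions). The local half of X_T. -/
theorem stub_diluteTwoShellPricing : DiluteTwoShellPricing := by
  sorry

/-- **Stub 2 — non-dilute regime.** A periodic competitor with bad fraction `> θ₀` is uniformly worse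
by some `κ(θ₀) > 0`: polytype selection at radius 2 (fcc/dhcp/... are entirely bad w.r.t. hcp) and
exclusion of amorphous / tetrahedrally close-packed near-minimisers; compactness of periodic
configurations in the local topology + uniqueness of the minimiser's two-shell atlas. The global,
qualitative half of X_T (no rate). -/
theorem stub_qualitativeTwoShellRigidity : QualitativeTwoShellRigidity := by
  sorry

namespace Registered
/-- registered stub signature -/
abbrev stub_diluteTwoShellPricing : Prop := DiluteTwoShellPricing
/-- registered stub signature -/
abbrev stub_qualitativeTwoShellRigidity : Prop := QualitativeTwoShellRigidity
end Registered

/-- The bad set is a subset of the motif, so its cardinality is at most `#motif`. -/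
theorem ncard_bad_le (P₀ P : PC) (η : ℝ) :
    ({x : E3 | x ∈ P.motif ∧ ¬ Good₂ P₀ P η x}.ncard : ℝ) ≤ P.motif.card := by
  have h : {x : E3 | x ∈ P.motif ∧ ¬ Good₂ P₀ P η x} ⊆ (↑P.motif : Set E3) := fun x hx => hx.1
  have h' := Set.ncard_le_ncard h (Finset.finite_toSet _)
  rw [Set.ncard_coe_finset] at h'
  exact_mod_cast h'

/-- **Composition (proved)**: the two regimes glue to `TwoShellDefectGap` with `g' = min g κ`. -/
theorem TwoShellDefectGap_of (h1 : Registered.stub_diluteTwoShellPricing)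
    (h2 : Registered.stub_qualitativeTwoShellRigidity) :
    TwoShellDefectGap := by
  intro P₀ hmin η hη
  obtain ⟨θ₀, g, hθ₀, hg, hdil⟩ := h1 P₀ hmin η hη
  obtain ⟨κ, hκ, hrig⟩ := h2 P₀ hmin η hη θ₀ hθ₀
  refine ⟨min g κ, lt_min hg hκ, fun P => ?_⟩
  show min g κ * (({x : E3 | x ∈ P.motif ∧ ¬ Good₂ P₀ P η x}.ncard : ℕ) : ℝ) ≤ _
  have hB := ncard_bad_le P₀ P η
  have hBnn : (0 : ℝ) ≤ ({x : E3 | x ∈ P.motif ∧ ¬ Good₂ P₀ P η x}.ncard : ℝ) := Nat.cast_nonneg _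
  by_cases hd : ({x : E3 | x ∈ P.motif ∧ ¬ Good₂ P₀ P η x}.ncard : ℝ) ≤ θ₀ * P.motif.card
  · have h := hdil P hd
    calc min g κ * ({x : E3 | x ∈ P.motif ∧ ¬ Good₂ P₀ P η x}.ncard : ℝ)
        ≤ g * ({x : E3 | x ∈ P.motif ∧ ¬ Good₂ P₀ P η x}.ncard : ℝ) := by
          gcongr; exact min_le_left _ _
      _ ≤ _ := h
  · push Not at hd
    have h := hrig P hd
    calc min g κ * ({x : E3 | x ∈ P.motif ∧ ¬ Good₂ P₀ P η x}.ncard : ℝ)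
        ≤ κ * ({x : E3 | x ∈ P.motif ∧ ¬ Good₂ P₀ P η x}.ncard : ℝ) := by
          gcongr; exact min_le_right _ _
      _ ≤ κ * P.motif.card := by gcongr
      _ ≤ _ := by
          rw [mul_comm]
          exact mul_le_mul_of_nonneg_left h (Nat.cast_nonneg _)

end Summit.AtomisticToContinuum.Crystallization.Cruxes.TwoShellDefectGap.TwoRegimesScaleTwo

end
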